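import Mathlib
import Summits.ValiantsHypothesis.ValiantsHypothesis.Theorems.ElementaryWordLengthWordLengthQPStubKappaTwoStructureAux
import Summits.ValiantsHypothesis.ValiantsHypothesis.Theorems.ElementaryWordLengthWordLengthQPStubKappaTwoStructureAuxB
import Summits.ValiantsHypothesis.ValiantsHypothesis.Theorems.ElementaryWordLengthWordLengthQPStubKappaTwoStructureAuxC
import Summits.ValiantsHypothesis.ValiantsHypothesis.Theorems.ElementaryWordLengthWordLengthQPStubKappaTwoStructureAuxD
import Summits.ValiantsHypothesis.ValiantsHypothesis.Theorems.ElementaryWordLengthWordLengthQPStubKappaTwoStructureAuxE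
import Summits.ValiantsHypothesis.ValiantsHypothesis.Theorems.ElementaryWordLengthWordLengthQPStubKappaTwoStructureAuxF
import Summits.ValiantsHypothesis.ValiantsHypothesis.Theorems.ElementaryWordLengthWordLengthQPStubKappaTwoStructureAuxG
import Summits.ValiantsHypothesis.ValiantsHypothesis.Theorems.ElementaryWordLengthWordLengthQPStubKappaTwoStructureAuxH
import Summits.ValiantsHypothesis.ValiantsHypothesis.Theorems.ElementaryWordLengthWordLengthQPStubKappaTwoStructureAuxI
import Summits.ValiantsHypothesis.ValiantsHypothesis.Theorems.ElementaryWordLengthWordLengthQPStubKappaTwoStructureAuxJ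

/-!
# Crux `WordLengthQP` (stmt-ValiantsHypothesis-6623), line `positive-monoid-exits` —
helpers for stub `stub_kappaTwoStructure`, part K: the word symmetry
`(i, j, c, o) ↦ (2 - j, 2 - i, c, o)` with reversal, and the `(x₂, y₂)` family.

The flip `φ` maps a word for `E₀₂(F)` to a word for `E₀₂(F)` (`J Wᵀ J = E₀₂(F)` for
`W = E₀₂(F)`), preserves validity, adjacency and coefficients (hence exits, tame and wild
letters), and maps the `(x₂, y₂)` family onto the `(y₁, x₁)` family, so `k2_family_II` follows
from `k2_family_I`.
-/

set_option linter.dupNamespace false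

noncomputable section

namespace Summit.ValiantsHypothesis.ValiantsHypothesis.Cruxes.WordLengthQP.PositiveMonoidExits

open MvPolynomial

/-- The flipped letter computes `J 𝕄(l)ᵀ J`. [folklore] -/
theorem k2_flip_letter {σ : Type} (l : Fin 3 × Fin 3 × ℝ × Option σ) :
    (Matrix.transvection (Prod.fst ((Fin.rev l.2.1, Fin.rev l.1, l.2.2))) (Prod.fst (Prod.snd ((Fin.rev l.2.1, Fin.rev l.1, l.2.2)))) (MvPolynomial.C (Prod.fst (Prod.snd (Prod.snd ((Fin.rev l.2.1, Fin.rev l.1, l.2.2))))) * Option.elim (Prod.snd (Prod.snd (Prod.snd ((Fin.rev l.2.1, Fin.rev l.1, l.2.2))))) 1 MvPolynomial.X) : Matrix (Fin 3) (Fin 3) (MvPolynomial σ ℝ)) = (((Matrix.transvection (Prod.fst l) (Prod.fst (Prod.snd l)) (MvPolynomial.C (Prod.fst (Prod.snd (Prod.snd l))) * Option.elim (Prod.snd (Prod.snd (Prod.snd l))) 1 MvPolynomial.X) : Matrix (Fin 3) (Fin 3) (MvPolynomial σ ℝ))).transpose).submatrix Fin.rev Fin.rev := by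
  rcases l with ⟨i, j, c, o⟩
  ext x y
  fin_cases i <;> fin_cases j <;> fin_cases x <;> fin_cases y <;> rfl

/-- The flipped reversed word computes `J Wᵀ J`. [folklore] -/
theorem k2_flip_prod {σ : Type} (w : List (Fin 3 × Fin 3 × ℝ × Option σ)) :
    (((w.map (fun l => (Fin.rev l.2.1, Fin.rev l.1, l.2.2))).reverse).map (fun l => (Matrix.transvection (Prod.fst l) (Prod.fst (Prod.snd l)) (MvPolynomial.C (Prod.fst (Prod.snd (Prod.snd l))) * Option.elim (Prod.snd (Prod.snd (Prod.snd l))) 1 MvPolynomial.X) : Matrix (Fin 3) (Fin 3) (MvPolynomial σ ℝ)))).prod =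
      (((w.map (fun l => (Matrix.transvection (Prod.fst l) (Prod.fst (Prod.snd l)) (MvPolynomial.C (Prod.fst (Prod.snd (Prod.snd l))) * Option.elim (Prod.snd (Prod.snd (Prod.snd l))) 1 MvPolynomial.X) : Matrix (Fin 3) (Fin 3) (MvPolynomial σ ℝ)))).prod).transpose).submatrix Fin.rev Fin.rev := by
  induction w with
  | nil =>
    simp only [List.map_nil, List.reverse_nil, List.prod_nil, Matrix.transpose_one]
    ext x y
    fin_cases x <;> fin_cases y <;> rfl
  | cons l w ih =>
    rw [List.map_cons, List.reverse_cons, List.map_append, List.prod_append, ih, List.map_cons,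
      List.prod_cons, List.map_cons, List.map_nil, List.prod_cons, List.prod_nil, mul_one,
      k2_flip_letter, Matrix.transpose_mul,
      Matrix.submatrix_mul _ _ Fin.rev Fin.rev Fin.rev Fin.rev_involutive.bijective]

/-- `J E₀₂(F)ᵀ J = E₀₂(F)`. [folklore] -/
theorem k2_flip_far {σ : Type} (F : MvPolynomial σ ℝ) :
    ((Matrix.transvection (0 : Fin 3) 2 F).transpose).submatrix Fin.rev Fin.rev =
      Matrix.transvection (0 : Fin 3) 2 F := by
  ext x y
  fin_cases x <;> fin_cases y <;> rfl

/-- Adjacency is flip-invariant. [folklore] -/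
theorem k2_flip_adj {σ : Type} (l : Fin 3 × Fin 3 × ℝ × Option σ) :
    (Fin.val (Prod.fst ((Fin.rev l.2.1, Fin.rev l.1, l.2.2))) + 1 = Fin.val (Prod.fst (Prod.snd ((Fin.rev l.2.1, Fin.rev l.1, l.2.2)))) ∨ Fin.val (Prod.fst (Prod.snd ((Fin.rev l.2.1, Fin.rev l.1, l.2.2)))) + 1 = Fin.val (Prod.fst ((Fin.rev l.2.1, Fin.rev l.1, l.2.2)))) ↔ (Fin.val (Prod.fst l) + 1 = Fin.val (Prod.fst (Prod.snd l)) ∨ Fin.val (Prod.fst (Prod.snd l)) + 1 = Fin.val (Prod.fst l)) := by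
  rcases l with ⟨i, j, c, o⟩
  fin_cases i <;> fin_cases j <;> simp

/-- **Family `(x₂, y₂)` is impossible** (by the flip symmetry from `k2_family_I`). [folklore] -/
theorem k2_family_II {σ : Type} (F : MvPolynomial σ ℝ)
    (hdeg : ∀ m ∈ F.support, 3 ≤ Finsupp.degree m) (hF0 : F ≠ 0)
    (p0 q p2 : List (Fin 3 × Fin 3 × ℝ × Option σ)) (L1 L2 : Fin 3 × Fin 3 × ℝ × Option σ)
    (hw : ∀ l ∈ p0 ++ L1 :: (q ++ L2 :: p2), l.1 ≠ l.2.1)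
    (ht : ∀ l ∈ p0 ++ q ++ p2, ((0 < Prod.fst (Prod.snd (Prod.snd l)) ∧ (Fin.val (Prod.fst l) + 1 = Fin.val (Prod.fst (Prod.snd l)) ∨ Fin.val (Prod.fst (Prod.snd l)) + 1 = Fin.val (Prod.fst l))) ∨ Prod.fst (Prod.snd (Prod.snd l)) = 0))
    (hL1 : L1.1 = 1 ∧ L1.2.1 = 2) (hL2 : L2.1 = 2 ∧ L2.2.1 = 1)
    (hF : ((p0 ++ L1 :: (q ++ L2 :: p2)).map (fun l => (Matrix.transvection (Prod.fst l) (Prod.fst (Prod.snd l)) (MvPolynomial.C (Prod.fst (Prod.snd (Prod.snd l))) * Option.elim (Prod.snd (Prod.snd (Prod.snd l))) 1 MvPolynomial.X) : Matrix (Fin 3) (Fin 3) (MvPolynomial σ ℝ)))).prod =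
      Matrix.transvection (0 : Fin 3) 2 F) : False := by
  set φ : Fin 3 × Fin 3 × ℝ × Option σ → Fin 3 × Fin 3 × ℝ × Option σ :=
    fun l => (Fin.rev l.2.1, Fin.rev l.1, l.2.2) with hφ
  have hflip := k2_flip_prod (p0 ++ L1 :: (q ++ L2 :: p2))
  rw [hF, k2_flip_far] at hflip
  have hw' : ∀ l ∈ (p2.map φ).reverse ++ φ L2 :: ((q.map φ).reverse ++ φ L1 :: (p0.map φ).reverse),
      l.1 ≠ l.2.1 := by
    intro l hl
    have : l ∈ ((p0 ++ L1 :: (q ++ L2 :: p2)).map φ).reverse := by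
      simpa [List.map_append, List.reverse_append] using hl
    rw [List.mem_reverse, List.mem_map] at this
    obtain ⟨l', hl', rfl⟩ := this
    have := hw l' hl'
    simp only [hφ, ne_eq, Fin.rev_inj]
    exact Ne.symm this
  have ht' : ∀ l ∈ (p2.map φ).reverse ++ (q.map φ).reverse ++ (p0.map φ).reverse, ((0 < Prod.fst (Prod.snd (Prod.snd l)) ∧ (Fin.val (Prod.fst l) + 1 = Fin.val (Prod.fst (Prod.snd l)) ∨ Fin.val (Prod.fst (Prod.snd l)) + 1 = Fin.val (Prod.fst l))) ∨ Prod.fst (Prod.snd (Prod.snd l)) = 0) := by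
    intro l hl
    have : ∃ l' ∈ p0 ++ q ++ p2, φ l' = l := by
      simp only [List.mem_append, List.mem_reverse, List.mem_map] at hl
      rcases hl with (⟨l', h, rfl⟩ | ⟨l', h, rfl⟩) | ⟨l', h, rfl⟩
      · exact ⟨l', by simp [h], rfl⟩
      · exact ⟨l', by simp [h], rfl⟩
      · exact ⟨l', by simp [h], rfl⟩
    obtain ⟨l', hl', rfl⟩ := this
    have h := ht l' hl'
    rw [hφ]
    exact (show ((0 < Prod.fst (Prod.snd (Prod.snd ((Fin.rev l'.2.1, Fin.rev l'.1, l'.2.2)))) ∧ (Fin.val (Prod.fst ((Fin.rev l'.2.1, Fin.rev l'.1, l'.2.2))) + 1 = Fin.val (Prod.fst (Prod.snd ((Fin.rev l'.2.1, Fin.rev l'.1, l'.2.2)))) ∨ Fin.val (Prod.fst (Prod.snd ((Fin.rev l'.2.1, Fin.rev l'.1, l'.2.2)))) + 1 = Fin.val (Prod.fst ((Fin.rev l'.2.1, Fin.rev l'.1, l'.2.2))))) ∨ Prod.fst (Prod.snd (Prod.snd ((Fin.rev l'.2.1, Fin.rev l'.1, l'.2.2)))) = 0) ↔ ((0 < Prod.fst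 (Prod.snd (Prod.snd l')) ∧ (Fin.val (Prod.fst l') + 1 = Fin.val (Prod.fst (Prod.snd l')) ∨ Fin.val (Prod.fst (Prod.snd l')) + 1 = Fin.val (Prod.fst l'))) ∨ Prod.fst (Prod.snd (Prod.snd l')) = 0) by rw [k2_flip_adj]).2 h
  refine k2_family_I F hdeg hF0 (p2.map φ).reverse (q.map φ).reverse (p0.map φ).reverse (φ L2) (φ L1)
    hw' ht' ⟨by simp [hφ, hL2.2], by simp [hφ, hL2.1]⟩ ⟨by simp [hφ, hL1.2], by simp [hφ, hL1.1]⟩ ?_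
  rw [← hflip]
  congr 1
  simp [List.map_append, List.reverse_append, hφ]

end Summit.ValiantsHypothesis.ValiantsHypothesis.Cruxes.WordLengthQP.PositiveMonoidExits

end
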